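import Summits.ABC.ABC.Statement
import Literature.NumberTheory.EllipticCurves.DegreeConjectureAbcMurtyProofs
import Literature.NumberTheory.Automorphic.ShimuraCurveRibetTakahashiPeterssonTwoPowerLevelProofs
import Literature.NumberTheory.Automorphic.ShimuraCurveRibetTakahashiPeterssonFreyHellegouarchProofs
import Literature.NumberTheory.Automorphic.ShimuraCurveRibetTakahashiFreyManinProofs
import Literature.NumberTheory.EllipticCurves.NeronIsogenyScalingHoldsProofs
import HarnessLib

/-!
# Stub-ideation k2, generation 2 (FAMILY 2 — RESHAPE) for `stub_primeToSixDegreeBound`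
# (crux `DefiniteXi.SteinbergCore`, stmt-ABC-15024, line `p6_tamagawa_split`)

Helper lemmas for the stub prover — ALL PROVED (0 `sorry`; `lean check` rc 0).
`Stub` is the registered stub verbatim.  Technique: (T1) REGIME SPLIT twice — 2-adic level
(`16 ∤ N`: the Petersson input is modularity-FREE, proved below; `16 ∣ N`: needs
`exists_isNewformOf`) and Szpiro tame/wild (`max(|a|,|b|) ≤ N^{1+ε/2}` closes outright; the wild
locus is where abc lives); (T2) QUANTIFIER CHANGE — abc enters only QUALITATIVELY, as finiteness of
the wild locus (`WildLocusFinite`), the constant absorbing the finitely many exceptions by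
`D.deg ≤ D'.deg` alone (no degree estimate on the wild locus).  Calibration: `WildLocusFinite ↔ ABC`
(`wildLocusFinite_iff_ABC`) — T2 relocates abc, it does not weaken it; what it buys is that the
stub HOLDS OUTRIGHT on the tame regime (`tameClosure_all_of_manin_of_modularity`, and
modularity-free for `16 ∤ N`: `tameClosure_off16_of_manin`).  End-to-end:
`stub_of_named_facts_of_ABC (hmod) (h102) (hopt) (hMK) (h : ABC) : Stub`.
Shared helper (same statement as k3 `StubIdeas3.MinimalDegUpper`, here with a regime predicate):
`MinimalDegUpperOn`.
-/

noncomputable section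

set_option linter.dupNamespace false

open scoped MatrixGroups

namespace Summit.ABC.ABC.Cruxes.SteinbergCore.StubIdeas2G2

open Literature.NumberTheory.EllipticCurves Literature.NumberTheory.EllipticCurves.ModularForms
open Literature.NumberTheory.DiophantineGeometry Literature.NumberTheory.Automorphic
open CongruenceSubgroup UniqueFactorizationMonoid IsDedekindDomain WeierstrassCurve NumberField

/-- The registered stub, verbatim. -/
def Stub : Prop :=
  ∀ ε : ℝ, 0 < ε → ∃ C : ℝ, ∀ a b : ℤ, IsCoprime a b → a * b * (a + b) ≠ 0 → ∀ (N : ℕ) [NeZero N], (Literature.NumberTheory.EllipticCurves.freyCurve a b).conductorNorm ℤ = N → ∀ D : Literature.NumberTheory.EllipticCurves.ModularForms.ModularParametrizationData (Literature.NumberTheory.EllipticCurves.freyCurve a b) N, (∀ D' : Literature.NumberTheory.EllipticCurves.ModularForms.ModularParametrizationData (Literature.NumberTheory.EllipticCurves.freyCurve a b) N, D.deg ≤ D'.deg) → ((D.deg / (ordProj[2] D.deg * ordProj[3] D.deg) : ℕ) : ℝ) ≤ C * (N : ℝ) ^ (2 + ε)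

/-- Sanity: `Stub` is literally the registered signature. -/
example : Stub ↔ (∀ ε : ℝ, 0 < ε → ∃ C : ℝ, ∀ a b : ℤ, IsCoprime a b → a * b * (a + b) ≠ 0 → ∀ (N : ℕ) [NeZero N], (Literature.NumberTheory.EllipticCurves.freyCurve a b).conductorNorm ℤ = N → ∀ D : Literature.NumberTheory.EllipticCurves.ModularForms.ModularParametrizationData (Literature.NumberTheory.EllipticCurves.freyCurve a b) N, (∀ D' : Literature.NumberTheory.EllipticCurves.ModularForms.ModularParametrizationData (Literature.NumberTheory.EllipticCurves.freyCurve a b) N, D.deg ≤ D'.deg) → ((D.deg / (ordProj[2] D.deg * ordProj[3] D.deg) : ℕ) : ℝ) ≤ C * (N : ℝ) ^ (2 + ε)) :=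
  Iff.rfl

/-! ## Shared binder: bounded Manin constants on Frey models (tree THEOREM modulo named facts:
`PastenShimura2024_cor_10_2.exists_freyCurve_datum_maninConstant_le h102 hopt hMK hNS`, with
`hNS := integral_neronScaling_of_isGloballyMinimal_holds` discharged — see k1 g2 `G3`). -/
def FreyManinBound : Prop :=
  ∃ M : ℕ, ∀ a b : ℤ, IsCoprime a b → a * b * (a + b) ≠ 0 →
    ∀ (N : ℕ) [NeZero N], (freyCurve a b).conductorNorm ℤ = N →
      ∃ D : ModularParametrizationData (freyCurve a b) N, D.maninConstant.natAbs ≤ M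

/-- `FreyManinBound` from the tree's named facts (= k1 g2 `G3`): Pasten 2024 Cor. 10.2 + Stevens /
Stein–Watkins optimal data + Mazur–Kenku, the Néron-scaling hypothesis being the tree THEOREM
`integral_neronScaling_of_isGloballyMinimal_holds`. -/
theorem freyManinBound_of_facts (h102 : PastenShimura2024_cor_10_2)
    (hopt : exists_optimal_modularParametrizationData) (hMK : mazurKenku_exists_cyclic_isogeny) :
    FreyManinBound :=
  PastenShimura2024_cor_10_2.exists_freyCurve_datum_maninConstant_le h102 hopt hMK
    integral_neronScaling_of_isGloballyMinimal_holds

/-! ## T1a — 2-adic regime split of the Petersson input -/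

/-- **L1 (PROVED, modularity-free)**: in the regime `16 ∤ N` the Petersson norm of the STUB'S OWN
newform `D.f` is `≤ C · N (1 + log N)³` — Mai–Murty's bound as landed for levels `2^t M`, `t ≤ 3`,
`M` odd squarefree (`exists_petersson_le_mul_log_cube_of_not_sixteen_dvd`, no `exists_isNewformOf`
hypothesis), Frey conductors being squarefree away from `2` (`conductorNorm_freyCurve_dvd_holds`). -/
theorem freyPetersson_off16 :
    ∃ C : ℝ, 0 < C ∧ ∀ a b : ℤ, IsCoprime a b → a * b * (a + b) ≠ 0 → ∀ (N : ℕ) [NeZero N],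
      (freyCurve a b).conductorNorm ℤ = N → ¬ 16 ∣ N →
      ∀ f : CuspForm (Gamma0 N) 2, IsNewformOf (freyCurve a b) f →
        (peterssonProduct (Gamma0 N) 2 f f).re ≤ C * N * (1 + Real.log N) ^ 3 := by
  obtain ⟨C, hC, h⟩ := exists_petersson_le_mul_log_cube_of_not_sixteen_dvd
  refine ⟨C, hC, fun a b hab h0 N _ hN h16 f hf => ?_⟩
  haveI := isElliptic_freyCurve h0
  have hodd : ∀ p : ℕ, p.Prime → p ≠ 2 → ¬ p ^ 2 ∣ N := by
    intro p hp hp2 hdvd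
    have hN' : N ∣ 2 ^ 8 * (radical (a * b * (a + b))).natAbs :=
      hN ▸ conductorNorm_freyCurve_dvd_holds a b hab h0
    have hcop : (p ^ 2).Coprime (2 ^ 8) :=
      Nat.Coprime.pow 2 8 ((Nat.coprime_primes hp Nat.prime_two).mpr hp2)
    have h3 : p ^ 2 ∣ (radical (a * b * (a + b))).natAbs :=
      hcop.dvd_of_dvd_mul_left (hdvd.trans hN')
    have hsf : Squarefree (radical (a * b * (a + b))).natAbs :=
      Int.squarefree_natAbs.mpr squarefree_radical
    exact hp.ne_one (Nat.isUnit_iff.mp (hsf p (by rw [← sq]; exact h3)))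
  exact h N h16 hodd (freyCurve a b) f hf

/-- **`MinimalDegUpperOn R θ`** (k3's `MinimalDegUpper θ` restricted to levels satisfying `R`):
a datum of MINIMAL degree on the Frey model has `deg ≤ K · N^{1+θ} · max(|a|,|b|)`. abc-FREE. -/
def MinimalDegUpperOn (R : ℕ → Prop) (θ : ℝ) : Prop :=
  ∃ K : ℝ, ∀ a b : ℤ, IsCoprime a b → a * b * (a + b) ≠ 0 → ∀ (N : ℕ) [NeZero N],
    (freyCurve a b).conductorNorm ℤ = N → R N → ∀ D : ModularParametrizationData (freyCurve a b) N,
      (∀ D' : ModularParametrizationData (freyCurve a b) N, D.deg ≤ D'.deg) →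
      (D.deg : ℝ) ≤ K * (N : ℝ) ^ (1 + θ) * max (|(a : ℝ)|) (|(b : ℝ)|)

/-- **L2 (M, one cycle; NO modularity fact)**: regime `16 ∤ N`.  Recipe = the tree proof of
`freyDegreeBound_rpow_of_abcLe_of_petersson_of_manin` (`DegreeConjectureAbcMurtyProofs`) with the
abc line deleted: Pasten's datum `D₀` (`|c₀| ≤ M`), `D.deg ≤ D₀.deg`, Zagier
`D₀.zagier_degree_formula_holds`, `L1` at `D₀.f` + `mul_one_add_log_pow_three_le_rpow` (`δ = min θ 1`),
Silverman `covolume_rpow_neg_six_le_of_isNeronLatticeOf` + `max_c₄_c₆_freyCurve_le` with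
`R := max |a| |b|`, `inv_le_of_rpow_neg_six_le`, `deg_le_of_zagier_of_upper`. -/
theorem minimalDegUpperOn_of_petersson (hM : FreyManinBound) {R : ℕ → Prop} {θ : ℝ}
    (hUp : ∃ C₂ : ℝ, ∀ a b : ℤ, IsCoprime a b → a * b * (a + b) ≠ 0 → ∀ (N : ℕ) [NeZero N],
      (freyCurve a b).conductorNorm ℤ = N → R N →
      ∀ f : CuspForm (Gamma0 N) 2, IsNewformOf (freyCurve a b) f →
        (peterssonProduct (Gamma0 N) 2 f f).re ≤ C₂ * (N : ℝ) ^ (1 + θ)) :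
    MinimalDegUpperOn R θ := by
  obtain ⟨C₂, hC₂⟩ := hUp
  obtain ⟨M, hMc⟩ := hM
  obtain ⟨A, hA, hSil⟩ := covolume_rpow_neg_six_le_of_isNeronLatticeOf
  set K : ℝ := 4 * Real.pi ^ 2 * (M : ℝ) ^ 2 * max C₂ 0 * (331776 * A) ^ (1 / 6 : ℝ) with hK
  refine ⟨K, fun a b hab h0 N _ hN hR D hDmin ↦ ?_⟩
  -- Pasten's datum `D₀` with `|c₀| ≤ M`; the MINIMAL datum `D` has `deg D ≤ deg D₀`
  obtain ⟨D₀, hDc⟩ := hMc a b hab h0 N hN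
  haveI := isElliptic_freyCurve h0
  have hNpos : (0 : ℝ) < N := by exact_mod_cast Nat.pos_of_ne_zero (NeZero.ne N)
  -- Zagier's identity `4π² c₀² (f₀,f₀) = deg D₀ · covol`
  have hZ := congrArg Complex.re D₀.zagier_degree_formula_holds
  rw [Complex.re_ofReal_mul, Complex.ofReal_re] at hZ
  have hP0 : 0 ≤ (peterssonProduct (Gamma0 N) 2 D₀.f D₀.f).re :=
    D₀.zagier_degree_formula_holds.peterssonProduct_re_pos.le
  have hcov : 0 < ZLattice.covolume D₀.L.lattice := ZLattice.covolume_pos _ _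
  -- the Petersson upper bound AT `D₀.f` (a newform of `E_{a,b}` supplied by the datum itself)
  have hP : (peterssonProduct (Gamma0 N) 2 D₀.f D₀.f).re ≤ max C₂ 0 * (N : ℝ) ^ (1 + θ) :=
    (hC₂ a b hab h0 N hN hR D₀.f D₀.isNewformOf).trans
      (mul_le_mul_of_nonneg_right (le_max_left _ _) (by positivity))
  -- the Manin constant
  have hc : |(D₀.c : ℝ)| ≤ M := by
    have h1 : ((D₀.c.natAbs : ℕ) : ℝ) ≤ M := by exact_mod_cast hDc
    rwa [Nat.cast_natAbs, Int.cast_abs] at h1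
  -- Silverman on the Frey model with `R' := max(|a|,|b|)` (NO abc here)
  set R' : ℝ := max (|(a : ℝ)|) (|(b : ℝ)|) with hR'
  have hR'0 : 0 ≤ R' := le_max_of_le_left (abs_nonneg _)
  have h6 : ZLattice.covolume D₀.L.lattice ^ (-(6 : ℝ)) ≤ (331776 * A) * R' ^ 6 := by
    calc ZLattice.covolume D₀.L.lattice ^ (-(6 : ℝ))
        ≤ A * ((max (|(freyCurve a b).c₄| ^ 3) (|(freyCurve a b).c₆| ^ 2) : ℚ) : ℝ) :=
          hSil (freyCurve a b) D₀.L D₀.isNeronLattice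
      _ ≤ A * (331776 * R' ^ 6) :=
          mul_le_mul_of_nonneg_left
            (max_c₄_c₆_freyCurve_le (le_max_left _ _) (le_max_right _ _)) hA.le
      _ = 331776 * A * R' ^ 6 := by ring
  have hinv := inv_le_of_rpow_neg_six_le hcov (by positivity) hR'0 h6
  have hdeg := deg_le_of_zagier_of_upper hcov hZ hc hP0 hP hinv
  have hmin : (D.deg : ℝ) ≤ (D₀.deg : ℝ) := by exact_mod_cast hDmin D₀
  calc (D.deg : ℝ) ≤ (D₀.deg : ℝ) := hmin
    _ = (D₀.modularDegree : ℝ) := rfl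
    _ ≤ 4 * Real.pi ^ 2 * (M : ℝ) ^ 2 * (max C₂ 0 * (N : ℝ) ^ (1 + θ)) *
          ((331776 * A) ^ (1 / 6 : ℝ) * R') := hdeg
    _ = K * (N : ℝ) ^ (1 + θ) * R' := by rw [hK]; ring

/-- **L2 (PROVED; NO modularity fact)**: regime `16 ∤ N` — `L1` at exponent `δ = min θ 1` via
`mul_one_add_log_pow_three_le_rpow`, fed to `minimalDegUpperOn_of_petersson`. -/
theorem minimalDegUpperOn_off16 (hM : FreyManinBound) {θ : ℝ} (hθ : 0 < θ) :
    MinimalDegUpperOn (fun N => ¬ 16 ∣ N) θ := by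
  apply minimalDegUpperOn_of_petersson hM
  obtain ⟨C, hC, h⟩ := freyPetersson_off16
  have hδ0 : 0 < min θ 1 := lt_min hθ one_pos
  have hδ1 : min θ 1 ≤ 1 := min_le_right _ _
  have hδθ : min θ 1 ≤ θ := min_le_left _ _
  refine ⟨C * 4 ^ 3 / (min θ 1) ^ 3, fun a b hab h0 N _ hN h16 f hf => ?_⟩
  have hN1 : (1 : ℝ) ≤ N := by exact_mod_cast NeZero.one_le (n := N)
  have h1 := h a b hab h0 N hN h16 f hf
  have h2 := mul_one_add_log_pow_three_le_rpow hN1 hδ0 hδ1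
  have h3 : (N : ℝ) ^ (1 + min θ 1) ≤ (N : ℝ) ^ (1 + θ) :=
    Real.rpow_le_rpow_of_exponent_le hN1 (by linarith)
  calc (peterssonProduct (Gamma0 N) 2 f f).re ≤ C * N * (1 + Real.log N) ^ 3 := h1
    _ = C * ((N : ℝ) * (1 + Real.log N) ^ 3) := by ring
    _ ≤ C * (4 ^ 3 * (N : ℝ) ^ (1 + min θ 1) / (min θ 1) ^ 3) :=
        mul_le_mul_of_nonneg_left h2 hC.le
    _ ≤ C * (4 ^ 3 * (N : ℝ) ^ (1 + θ) / (min θ 1) ^ 3) := by gcongr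
    _ = C * 4 ^ 3 / (min θ 1) ^ 3 * (N : ℝ) ^ (1 + θ) := by ring

/-- **L2' (M, one cycle; needs BCDT as the named fact `exists_isNewformOf`)**: all levels — the same
recipe with the Petersson input `exists_petersson_le_mul_rpow_of_exists_isNewformOf hmod` and the
Diamond–Kramer dichotomy `not_sixtyfour_dvd_conductorNorm_freyCurve_or_quadraticTwist_neg_one`
(= k1 g2 `G1`, proved in `STUB_IDEAS_stub_primeToSixDegreeBound_1_g2.lean`). -/
theorem minimalDegUpperOn_all (hM : FreyManinBound) (hmod : exists_isNewformOf) {θ : ℝ} (hθ : 0 < θ) :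
    MinimalDegUpperOn (fun _ => True) θ := by
  apply minimalDegUpperOn_of_petersson hM
  -- k1 g2 `G1` (`freyPeterssonUpper_of_modularity`), inlined to keep this file self-contained
  obtain ⟨C, hC, hmain⟩ := exists_petersson_le_mul_rpow_of_exists_isNewformOf hmod
  have hδ : 0 < min θ 1 := lt_min hθ one_pos
  have hδ1 : min θ 1 ≤ 1 := min_le_right _ _
  have hδt : min θ 1 ≤ θ := min_le_left _ _
  refine ⟨C / (min θ 1) ^ 3, fun a b hab h0 N _ hN _ f hf => ?_⟩
  haveI := isElliptic_freyCurve h0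
  -- (i) `N` is square-free away from `2`
  have hodd : ∀ p : ℕ, p.Prime → p ≠ 2 → ¬ p ^ 2 ∣ N := by
    intro p hp hp2 hdvd
    have hN' : N ∣ 2 ^ 8 * (radical (a * b * (a + b))).natAbs :=
      hN ▸ conductorNorm_freyCurve_dvd_holds a b hab h0
    have hcop : (p ^ 2).Coprime (2 ^ 8) :=
      Nat.Coprime.pow 2 8 ((Nat.coprime_primes hp Nat.prime_two).mpr hp2)
    have h3 : p ^ 2 ∣ (radical (a * b * (a + b))).natAbs :=
      hcop.dvd_of_dvd_mul_left (hdvd.trans hN')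
    have hsf : Squarefree (radical (a * b * (a + b))).natAbs :=
      Int.squarefree_natAbs.mpr squarefree_radical
    exact hp.ne_one (Nat.isUnit_iff.mp (hsf p (by rw [← sq]; exact h3)))
  -- (ii) the Diamond–Kramer `64`-dichotomy
  have hcase : ¬ 64 ∣ N ∨ ∃ d : ℤ, (d = -1 ∨ d = 2 ∨ d = -2) ∧
      ¬ 64 ∣ ((freyCurve a b).quadraticTwist (d : ℚ)).conductorNorm ℤ := by
    rcases not_sixtyfour_dvd_conductorNorm_freyCurve_or_quadraticTwist_neg_one hab h0 with h | h
    · exact Or.inl (hN ▸ h)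
    · refine Or.inr ⟨-1, Or.inl rfl, ?_⟩
      push_cast
      exact h
  have hN1 : (1 : ℝ) ≤ N := by exact_mod_cast NeZero.one_le (n := N)
  have h1 : (N : ℝ) ^ (1 + min θ 1) ≤ (N : ℝ) ^ (1 + θ) :=
    Real.rpow_le_rpow_of_exponent_le hN1 (by linarith)
  calc (peterssonProduct (Gamma0 N) 2 f f).re ≤ C * (N : ℝ) ^ (1 + min θ 1) / (min θ 1) ^ 3 :=
        hmain (min θ 1) hδ hδ1 N (freyCurve a b) f hf hodd hcase
    _ ≤ C * (N : ℝ) ^ (1 + θ) / (min θ 1) ^ 3 :=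
        div_le_div_of_nonneg_right (mul_le_mul_of_nonneg_left h1 hC.le) (pow_pos hδ 3).le
    _ = C / (min θ 1) ^ 3 * (N : ℝ) ^ (1 + θ) := by ring

/-! ## T1b — Szpiro tame / wild regime -/

/-- **Tame closure on levels satisfying `R`**: the stub WITH ONE EXTRA HYPOTHESIS
`max(|a|,|b|) ≤ N^{1+ε/2}` (verbatim prefix and conclusion otherwise). -/
def TameClosureOn (R : ℕ → Prop) : Prop :=
  ∀ ε : ℝ, 0 < ε → ∃ C : ℝ, ∀ a b : ℤ, IsCoprime a b → a * b * (a + b) ≠ 0 → ∀ (N : ℕ) [NeZero N],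
    (freyCurve a b).conductorNorm ℤ = N → R N → max (|(a : ℝ)|) (|(b : ℝ)|) ≤ (N : ℝ) ^ (1 + ε / 2) →
    ∀ D : ModularParametrizationData (freyCurve a b) N,
      (∀ D' : ModularParametrizationData (freyCurve a b) N, D.deg ≤ D'.deg) →
      ((D.deg / (ordProj[2] D.deg * ordProj[3] D.deg) : ℕ) : ℝ) ≤ C * (N : ℝ) ^ (2 + ε)

/-- **L3 (S, PROVED)**: `MinimalDegUpperOn R (ε/2)` closes the tame regime: `cps n ≤ n`,
`deg ≤ K N^{1+ε/2} · N^{1+ε/2} = K N^{2+ε}`. -/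
theorem tameClosureOn_of_minimalDegUpperOn {R : ℕ → Prop}
    (h : ∀ θ : ℝ, 0 < θ → MinimalDegUpperOn R θ) : TameClosureOn R := by
  intro ε hε
  obtain ⟨K, hK⟩ := h (ε / 2) (half_pos hε)
  refine ⟨max K 0, fun a b hab h0 N _ hN hR hH D hDmin => ?_⟩
  have hNpos : (0 : ℝ) < N := by exact_mod_cast Nat.pos_of_ne_zero (NeZero.ne N)
  have h1 : ((D.deg / (ordProj[2] D.deg * ordProj[3] D.deg) : ℕ) : ℝ) ≤ (D.deg : ℝ) := by
    exact_mod_cast Nat.div_le_self _ _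
  have h2 := hK a b hab h0 N hN hR D hDmin
  have hmax0 : 0 ≤ max (|(a : ℝ)|) (|(b : ℝ)|) := le_max_of_le_left (abs_nonneg _)
  have hpow0 : 0 ≤ (N : ℝ) ^ (1 + ε / 2) := Real.rpow_nonneg hNpos.le _
  have hexp : (N : ℝ) ^ (1 + ε / 2) * (N : ℝ) ^ (1 + ε / 2) = (N : ℝ) ^ (2 + ε) := by
    rw [← Real.rpow_add hNpos]; congr 1; ring
  calc ((D.deg / (ordProj[2] D.deg * ordProj[3] D.deg) : ℕ) : ℝ) ≤ (D.deg : ℝ) := h1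
    _ ≤ K * (N : ℝ) ^ (1 + ε / 2) * max (|(a : ℝ)|) (|(b : ℝ)|) := h2
    _ ≤ max K 0 * (N : ℝ) ^ (1 + ε / 2) * max (|(a : ℝ)|) (|(b : ℝ)|) := by
        gcongr
        exact le_max_left _ _
    _ ≤ max K 0 * (N : ℝ) ^ (1 + ε / 2) * (N : ℝ) ^ (1 + ε / 2) := by gcongr
    _ = max K 0 * (N : ℝ) ^ (2 + ε) := by rw [mul_assoc, hexp]

/-- Regime glue (S): the two 2-adic regimes give all levels. -/
theorem tameClosureOn_all_of_split (h₁ : TameClosureOn (fun N => ¬ 16 ∣ N))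
    (h₂ : TameClosureOn (fun N => 16 ∣ N)) : TameClosureOn (fun _ => True) := by
  intro ε hε
  obtain ⟨C₁, hC₁⟩ := h₁ ε hε
  obtain ⟨C₂, hC₂⟩ := h₂ ε hε
  refine ⟨max C₁ C₂, fun a b hab h0 N _ hN _ hH D hDmin => ?_⟩
  have hNpow : 0 ≤ (N : ℝ) ^ (2 + ε) := Real.rpow_nonneg (Nat.cast_nonneg N) _
  by_cases h16 : 16 ∣ N
  · exact (hC₂ a b hab h0 N hN h16 hH D hDmin).trans
      (mul_le_mul_of_nonneg_right (le_max_right _ _) hNpow)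
  · exact (hC₁ a b hab h0 N hN h16 hH D hDmin).trans
      (mul_le_mul_of_nonneg_right (le_max_left _ _) hNpow)

/-! ## T2 — abc enters only as FINITENESS of the wild locus -/

/-- **The wild locus is finite for every `ε`**: only finitely many coprime `(a,b)`, `ab(a+b) ≠ 0`,
have `max(|a|,|b|) > N_{E_(a,b)}^{1+ε}`.  The finiteness (= quality) form of abc transported to
conductors (`rad ∣ 2N`, `N ∣ 2⁸ rad`); cf. `ABCQualityForm`, `abcQualityForm_iff_forall_exists_const`. -/
def WildLocusFinite : Prop :=
  ∀ ε : ℝ, 0 < ε →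
    {p : ℤ × ℤ | IsCoprime p.1 p.2 ∧ p.1 * p.2 * (p.1 + p.2) ≠ 0 ∧
      (((freyCurve p.1 p.2).conductorNorm ℤ : ℕ) : ℝ) ^ (1 + ε) <
        max (|(p.1 : ℝ)|) (|(p.2 : ℝ)|)}.Finite

/-- **L4 (PROVED)**: `ABC → WildLocusFinite` — `abc_int_of_abcLe` at `ε/2` on the triple
`a + b + (−(a+b)) = 0` gives `|a|, |b| ≤ C rad^{1+ε/2} ≤ C (2N)^{1+ε/2}`
(`radical_natAbs_dvd_two_mul_conductorNorm_freyCurve`); on the wild locus `N^{1+ε} < C' N^{1+ε/2}`,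
so `N`, hence `|a|, |b|`, are bounded: the locus sits in a finite box of `ℤ × ℤ`. -/
theorem wildLocusFinite_of_ABC (h : _root_.ABC) : WildLocusFinite := by
  intro ε hε
  -- abc in the printed `≤`-form, then its signed form at `ε/2`
  have habc : ∀ η : ℝ, 0 < η → ∃ C : ℝ, ∀ a b c : ℕ, Literature.NumberTheory.DiophantineGeometry.IsABCTriple a b c →
      (c : ℝ) ≤ C * ((Literature.NumberTheory.DiophantineGeometry.rad a b c : ℕ) : ℝ) ^ (1 + η) := by
    intro η hη
    obtain ⟨C, -, hC⟩ := (ABC_iff.mp h) η hη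
    exact ⟨C, fun a b c habc => (hC a b c habc).le⟩
  obtain ⟨Cabc, hCabc1, hCabc⟩ := Literature.NumberTheory.DiophantineGeometry.abc_int_of_abcLe habc (half_pos hε)
  have hCabc0 : 0 ≤ Cabc := zero_le_one.trans hCabc1
  have hε0 : ε ≠ 0 := hε.ne'
  -- constants: `max(|a|,|b|) ≤ K · N^{1+ε/2}`; on the wild locus `N ≤ N₀`, so `max ≤ B`
  set K : ℝ := Cabc * 2 ^ (1 + ε / 2) with hK
  have hK1 : 1 ≤ K :=
    one_le_mul_of_one_le_of_one_le hCabc1 (Real.one_le_rpow (by norm_num) (by positivity))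
  have hK0 : 0 ≤ K := zero_le_one.trans hK1
  set N₀ : ℝ := K ^ (2 / ε) with hN₀
  set B : ℝ := K * N₀ ^ (1 + ε / 2) with hB
  obtain ⟨Bn, hBn⟩ := exists_nat_ge B
  refine ((Set.finite_Icc (-(Bn : ℤ)) Bn).prod (Set.finite_Icc (-(Bn : ℤ)) Bn)).subset ?_
  rintro ⟨a, b⟩ ⟨hab, h0, hwild⟩
  dsimp only at hab h0 hwild
  have ha0 : a ≠ 0 := fun h ↦ h0 (by simp [h])
  have hb0 : b ≠ 0 := fun h ↦ h0 (by simp [h])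
  have hab0 : a + b ≠ 0 := fun h ↦ h0 (by simp [h])
  obtain ⟨haR, hbR, -⟩ := hCabc a b (-(a + b)) ha0 hb0 (neg_ne_zero.mpr hab0) hab (by ring)
  have hnat : (a * b * -(a + b)).natAbs = (a * b * (a + b)).natAbs := by
    rw [show a * b * -(a + b) = -(a * b * (a + b)) by ring, Int.natAbs_neg]
  rw [hnat, Nat.cast_natAbs, Int.cast_abs] at haR hbR
  -- the conductor is a positive integer
  haveI := isElliptic_freyCurve h0
  have hNpos' : 0 < (freyCurve a b).conductorNorm ℤ := (freyCurve a b).conductorNorm_pos_holds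
  obtain ⟨N, hN⟩ : ∃ N : ℕ, (freyCurve a b).conductorNorm ℤ = N := ⟨_, rfl⟩
  rw [hN] at hNpos' hwild
  have hNpos : (0 : ℝ) < N := by exact_mod_cast hNpos'
  -- `rad(ab(a+b)) ≤ 2N`
  have hrN : ((radical (a * b * (a + b)).natAbs : ℕ) : ℝ) ≤ 2 * N := by
    have hdvd := radical_natAbs_dvd_two_mul_conductorNorm_freyCurve hab h0
    rw [hN] at hdvd
    exact_mod_cast Nat.le_of_dvd (by positivity) hdvd
  have hR : Cabc * ((radical (a * b * (a + b)).natAbs : ℕ) : ℝ) ^ (1 + ε / 2) ≤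
      K * (N : ℝ) ^ (1 + ε / 2) := by
    rw [hK]
    calc Cabc * ((radical (a * b * (a + b)).natAbs : ℕ) : ℝ) ^ (1 + ε / 2)
        ≤ Cabc * (2 * (N : ℝ)) ^ (1 + ε / 2) :=
          mul_le_mul_of_nonneg_left (Real.rpow_le_rpow (by positivity) hrN (by positivity)) hCabc0
      _ = Cabc * 2 ^ (1 + ε / 2) * (N : ℝ) ^ (1 + ε / 2) := by
          rw [Real.mul_rpow (by norm_num) hNpos.le]; ring
  have hmax : max (|(a : ℝ)|) (|(b : ℝ)|) ≤ K * (N : ℝ) ^ (1 + ε / 2) :=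
    max_le (haR.trans hR) (hbR.trans hR)
  -- on the wild locus `N^{1+ε} < K N^{1+ε/2}`, so `N ≤ N₀ = K^{2/ε}`
  have hNle : (N : ℝ) ≤ N₀ := by
    have h1 : (N : ℝ) ^ (1 + ε) < K * (N : ℝ) ^ (1 + ε / 2) := hwild.trans_le hmax
    have hsplit : (N : ℝ) ^ (1 + ε) = (N : ℝ) ^ (ε / 2) * (N : ℝ) ^ (1 + ε / 2) := by
      rw [← Real.rpow_add hNpos]; congr 1; ring
    rw [hsplit] at h1
    have h2 : (N : ℝ) ^ (ε / 2) < K := lt_of_mul_lt_mul_right h1 (by positivity)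
    have hexp : ε / 2 * (2 / ε) = 1 := by
      rw [div_mul_div_comm, mul_comm ε 2, div_self (by positivity)]
    have h3 : ((N : ℝ) ^ (ε / 2)) ^ (2 / ε) = N := by
      rw [← Real.rpow_mul hNpos.le, hexp, Real.rpow_one]
    calc (N : ℝ) = ((N : ℝ) ^ (ε / 2)) ^ (2 / ε) := h3.symm
      _ ≤ K ^ (2 / ε) := Real.rpow_le_rpow (by positivity) h2.le (by positivity)
      _ = N₀ := by rw [hN₀]
  have hmaxB : max (|(a : ℝ)|) (|(b : ℝ)|) ≤ Bn := by
    calc max (|(a : ℝ)|) (|(b : ℝ)|) ≤ K * (N : ℝ) ^ (1 + ε / 2) := hmax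
      _ ≤ K * N₀ ^ (1 + ε / 2) :=
          mul_le_mul_of_nonneg_left (Real.rpow_le_rpow hNpos.le hNle (by positivity)) hK0
      _ = B := by rw [hB]
      _ ≤ Bn := hBn
  have haI : |a| ≤ (Bn : ℤ) := by
    have := (le_max_left _ _).trans hmaxB
    exact_mod_cast this
  have hbI : |b| ≤ (Bn : ℤ) := by
    have := (le_max_right _ _).trans hmaxB
    exact_mod_cast this
  exact Set.mk_mem_prod (Set.mem_Icc.mpr (abs_le.mp haI)) (Set.mem_Icc.mpr (abs_le.mp hbI))

/-- **Calibration (PROVED; honesty about T2)**: `WildLocusFinite` gives back `ABC`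
(`N ∣ 2⁸ rad(abc)`, `c ≤ 2 max(a,b)` off the finite wild set, `c ≤ |a|+|b| ≤ B` on it) — so the
reshaping RELOCATES abc to the complement of the tame regime; it does not weaken it. -/
theorem ABC_of_wildLocusFinite (hW : WildLocusFinite) : _root_.ABC := by
  classical
  rw [ABC_iff]
  intro ε hε
  have hfin := hW ε hε
  set B : ℝ := ∑ p ∈ hfin.toFinset, (|(p.1 : ℝ)| + |(p.2 : ℝ)|) with hB
  have hB0 : 0 ≤ B := Finset.sum_nonneg fun p _ => by positivity
  have hK0 : (0 : ℝ) ≤ 2 * (2 ^ 8) ^ (1 + ε) := by positivity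
  refine ⟨2 * (2 ^ 8) ^ (1 + ε) + B + 1, by linarith, fun a b c h => ?_⟩
  obtain ⟨ha, hb, habc, hcop⟩ := h
  have hab : IsCoprime (a : ℤ) (b : ℤ) := Nat.isCoprime_iff_coprime.mpr hcop
  have h0 : (a : ℤ) * b * (a + b) ≠ 0 := by positivity
  haveI := isElliptic_freyCurve h0
  have hNpos' : 0 < (freyCurve (a : ℤ) (b : ℤ)).conductorNorm ℤ :=
    (freyCurve (a : ℤ) (b : ℤ)).conductorNorm_pos_holds
  -- `N ∣ 2⁸ rad(abc)`
  have hPz : (a : ℤ) * b * (a + b) = ((a * b * c : ℕ) : ℤ) := by rw [← habc]; push_cast; ring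
  have hdvd : (freyCurve (a : ℤ) (b : ℤ)).conductorNorm ℤ ∣
      2 ^ 8 * Literature.NumberTheory.DiophantineGeometry.rad a b c := by
    have h1 := conductorNorm_freyCurve_dvd_holds (a : ℤ) (b : ℤ) hab h0
    have h2 : (radical ((a : ℤ) * b * (a + b))).natAbs =
        Literature.NumberTheory.DiophantineGeometry.rad a b c := by
      rw [Literature.NumberTheory.DiophantineGeometry.rad_def, hPz,
        ← Int.radical_natAbs_eq_radical, Int.natAbs_natCast, Int.natAbs_natCast]
    rwa [h2] at h1
  obtain ⟨N, hN⟩ : ∃ N : ℕ, (freyCurve (a : ℤ) (b : ℤ)).conductorNorm ℤ = N := ⟨_, rfl⟩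
  rw [hN] at hNpos' hdvd
  have hRpos : 0 < Literature.NumberTheory.DiophantineGeometry.rad a b c := by
    rw [Literature.NumberTheory.DiophantineGeometry.rad_def]
    exact Nat.pos_of_ne_zero radical_ne_zero
  set R : ℝ := ((Literature.NumberTheory.DiophantineGeometry.rad a b c : ℕ) : ℝ) with hRdef
  have hR1 : (1 : ℝ) ≤ R := by rw [hRdef]; exact_mod_cast hRpos
  have hR0 : (0 : ℝ) < R := one_pos.trans_le hR1
  have hRpow0 : (0 : ℝ) < R ^ (1 + ε) := Real.rpow_pos_of_pos hR0 _
  have hRpow1 : (1 : ℝ) ≤ R ^ (1 + ε) := Real.one_le_rpow hR1 (by linarith)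
  have hNle : (N : ℝ) ≤ 2 ^ 8 * R := by
    rw [hRdef]; exact_mod_cast Nat.le_of_dvd (by positivity) hdvd
  have hca : ((a : ℤ) : ℝ) = (a : ℝ) := Int.cast_natCast a
  have hcb : ((b : ℤ) : ℝ) = (b : ℝ) := Int.cast_natCast b
  have hc_le : (c : ℝ) ≤ |((a : ℤ) : ℝ)| + |((b : ℤ) : ℝ)| := by
    rw [hca, hcb, abs_of_nonneg (Nat.cast_nonneg _), abs_of_nonneg (Nat.cast_nonneg _)]
    have : (c : ℝ) = a + b := by rw [← habc]; push_cast; ring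
    rw [this]
  by_cases hwild : ((N : ℕ) : ℝ) ^ (1 + ε) < max (|((a : ℤ) : ℝ)|) (|((b : ℤ) : ℝ)|)
  · -- in the finite wild set: `c ≤ |a| + |b| ≤ B`
    have hmem : ((a : ℤ), (b : ℤ)) ∈ hfin.toFinset := by
      simp only [Set.Finite.mem_toFinset, Set.mem_setOf_eq]
      exact ⟨hab, h0, by rw [hN]; exact hwild⟩
    have h1 : |((a : ℤ) : ℝ)| + |((b : ℤ) : ℝ)| ≤ B := by
      rw [hB]
      exact Finset.single_le_sum (f := fun p : ℤ × ℤ => |(p.1 : ℝ)| + |(p.2 : ℝ)|)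
        (fun p _ => by positivity) hmem
    calc (c : ℝ) ≤ B := hc_le.trans h1
      _ < (2 * (2 ^ 8) ^ (1 + ε) + B + 1) * 1 := by rw [mul_one]; linarith
      _ ≤ (2 * (2 ^ 8) ^ (1 + ε) + B + 1) * R ^ (1 + ε) :=
          mul_le_mul_of_nonneg_left hRpow1 (by linarith)
  · -- tame: `max(|a|,|b|) ≤ N^{1+ε} ≤ (2⁸ R)^{1+ε}`
    have hmax : max (|((a : ℤ) : ℝ)|) (|((b : ℤ) : ℝ)|) ≤ (N : ℝ) ^ (1 + ε) := not_lt.mp hwild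
    have hNR : (N : ℝ) ^ (1 + ε) ≤ (2 ^ 8) ^ (1 + ε) * R ^ (1 + ε) := by
      rw [← Real.mul_rpow (by norm_num) hR0.le]
      exact Real.rpow_le_rpow (by positivity) hNle (by linarith)
    have hm1 := le_max_left (|((a : ℤ) : ℝ)|) (|((b : ℤ) : ℝ)|)
    have hm2 := le_max_right (|((a : ℤ) : ℝ)|) (|((b : ℤ) : ℝ)|)
    calc (c : ℝ) ≤ |((a : ℤ) : ℝ)| + |((b : ℤ) : ℝ)| := hc_le
      _ ≤ 2 * ((2 ^ 8) ^ (1 + ε) * R ^ (1 + ε)) := by linarith [hmax.trans hNR]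
      _ = 2 * (2 ^ 8) ^ (1 + ε) * R ^ (1 + ε) := by ring
      _ < (2 * (2 ^ 8) ^ (1 + ε) + B + 1) * R ^ (1 + ε) := by
          apply mul_lt_mul_of_pos_right _ hRpow0
          linarith

/-- `WildLocusFinite` is EXACTLY abc (calibration of the T2 currency). -/
theorem wildLocusFinite_iff_ABC : WildLocusFinite ↔ _root_.ABC :=
  ⟨ABC_of_wildLocusFinite, wildLocusFinite_of_ABC⟩

/-- **L5 (PROVED) — ASSEMBLY**: tame closure on all levels + finiteness of the wild locus give
the stub: `TameClosureOn ⊤` at `ε` (hypothesis `max ≤ N^{1+ε/2}`) off the wild locus of exponent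
`ε/2`; on the finite wild set `C₂ := Σ_{(a,b) wild} m(a,b)`, `m(a,b) := sInf` of the degrees of data on
`E_{a,b}` (`= D.deg` for a MINIMAL datum, by `D.deg ≤ D'.deg`), `cps n ≤ n`, `1 ≤ N^{2+ε}` — no
estimate at all on the wild locus. -/
theorem stub_of_tame_of_wildFinite (hT : TameClosureOn (fun _ => True)) (hW : WildLocusFinite) :
    Stub := by
  classical
  intro ε hε
  obtain ⟨C₁, hC₁⟩ := hT ε hε
  have hfin := hW (ε / 2) (half_pos hε)
  -- the set of degrees of data on the Frey model of `p` (at the level of its conductor)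
  let S : ℤ × ℤ → Set ℕ := fun p =>
    {d : ℕ | ∃ (N : ℕ) (_ : NeZero N), (freyCurve p.1 p.2).conductorNorm ℤ = N ∧
      ∃ D : ModularParametrizationData (freyCurve p.1 p.2) N, D.deg = d}
  let m : ℤ × ℤ → ℕ := fun p => sInf (S p)
  set C₂ : ℝ := ∑ p ∈ hfin.toFinset, (m p : ℝ) with hC₂
  have hC₂0 : 0 ≤ C₂ := Finset.sum_nonneg fun p _ => Nat.cast_nonneg _
  have hK0 : 0 ≤ max C₁ 0 + C₂ := add_nonneg (le_max_right _ _) hC₂0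
  refine ⟨max C₁ 0 + C₂, fun a b hab h0 N _ hN D hDmin => ?_⟩
  have hN1 : (1 : ℝ) ≤ N := by exact_mod_cast NeZero.one_le (n := N)
  have hNpow1 : (1 : ℝ) ≤ (N : ℝ) ^ (2 + ε) := Real.one_le_rpow hN1 (by linarith)
  have hNpow0 : (0 : ℝ) ≤ (N : ℝ) ^ (2 + ε) := zero_le_one.trans hNpow1
  have hcps : ((D.deg / (ordProj[2] D.deg * ordProj[3] D.deg) : ℕ) : ℝ) ≤ (D.deg : ℝ) := by
    exact_mod_cast Nat.div_le_self _ _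
  by_cases hwild : (((freyCurve a b).conductorNorm ℤ : ℕ) : ℝ) ^ (1 + ε / 2) <
      max (|(a : ℝ)|) (|(b : ℝ)|)
  · -- WILD: `(a,b)` lies in the finite exceptional set; no estimate, only minimality
    have hmem : (a, b) ∈ hfin.toFinset := by
      simp only [Set.Finite.mem_toFinset, Set.mem_setOf_eq]
      exact ⟨hab, h0, hwild⟩
    have hDS : D.deg ∈ S (a, b) := ⟨N, inferInstance, hN, D, rfl⟩
    have hlow : ∀ d ∈ S (a, b), D.deg ≤ d := by
      rintro d ⟨N', _, hN', D', rfl⟩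
      have hNN' : N = N' := hN.symm.trans hN'
      subst hNN'
      exact hDmin D'
    have hm : m (a, b) = D.deg :=
      le_antisymm (Nat.sInf_le hDS) (le_csInf ⟨_, hDS⟩ hlow)
    have h1 : (D.deg : ℝ) ≤ C₂ := by
      have h2 : (m (a, b) : ℝ) ≤ C₂ := by
        rw [hC₂]
        exact Finset.single_le_sum (fun p _ => Nat.cast_nonneg (m p)) hmem
      rwa [hm] at h2
    calc ((D.deg / (ordProj[2] D.deg * ordProj[3] D.deg) : ℕ) : ℝ) ≤ (D.deg : ℝ) := hcps
      _ ≤ C₂ := h1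
      _ ≤ (max C₁ 0 + C₂) * 1 := by rw [mul_one]; linarith [le_max_right C₁ 0]
      _ ≤ (max C₁ 0 + C₂) * (N : ℝ) ^ (2 + ε) := mul_le_mul_of_nonneg_left hNpow1 hK0
  · -- TAME: the extra hypothesis of `TameClosureOn` holds
    have hH : max (|(a : ℝ)|) (|(b : ℝ)|) ≤ (N : ℝ) ^ (1 + ε / 2) := by
      rw [hN] at hwild
      exact not_lt.mp hwild
    calc ((D.deg / (ordProj[2] D.deg * ordProj[3] D.deg) : ℕ) : ℝ) ≤ C₁ * (N : ℝ) ^ (2 + ε) :=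
          hC₁ a b hab h0 N hN trivial hH D hDmin
      _ ≤ (max C₁ 0 + C₂) * (N : ℝ) ^ (2 + ε) := by
          apply mul_le_mul_of_nonneg_right _ hNpow0
          linarith [le_max_left C₁ 0]

/-- **Certificate (PROVED, 0 sorry)**: the stub from bounded Manin constants, Modularity (consumed only
through the Petersson bound, and only needed for `16 ∣ N`) and abc used qualitatively
(`WildLocusFinite`). -/
theorem stub_of_facts_of_ABC (hM : FreyManinBound) (hmod : exists_isNewformOf) (h : _root_.ABC) :
    Stub :=
  stub_of_tame_of_wildFinite
    (tameClosureOn_of_minimalDegUpperOn fun _ hθ => minimalDegUpperOn_all hM hmod hθ)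
    (wildLocusFinite_of_ABC h)

/-- **Regime-`16 ∤ N` certificate with NO modularity fact and NO abc (PROVED)**. -/
theorem tameClosure_off16_of_manin (hM : FreyManinBound) : TameClosureOn (fun N => ¬ 16 ∣ N) :=
  tameClosureOn_of_minimalDegUpperOn fun _ hθ => minimalDegUpperOn_off16 hM hθ

/-- **All-level tame certificate, NO abc (PROVED)**: the stub HOLDS outright on the Szpiro-tame
regime `max(|a|,|b|) ≤ N^{1+ε/2}`, from bounded Manin constants + Modularity alone. -/
theorem tameClosure_all_of_manin_of_modularity (hM : FreyManinBound) (hmod : exists_isNewformOf) :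
    TameClosureOn (fun _ => True) :=
  tameClosureOn_of_minimalDegUpperOn fun _ hθ => minimalDegUpperOn_all hM hmod hθ

/-- **End-to-end certificate over the tree's NAMED FACTS (PROVED, 0 sorry)** — same binder set as
k1 g2 `p6_of_ABC_of_facts`, reached through the regime split: Modularity (BCDT), Pasten Cor. 10.2,
optimal data, Mazur–Kenku, and abc used only as `WildLocusFinite`. -/
theorem stub_of_named_facts_of_ABC (hmod : exists_isNewformOf) (h102 : PastenShimura2024_cor_10_2)
    (hopt : exists_optimal_modularParametrizationData) (hMK : mazurKenku_exists_cyclic_isogeny)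
    (h : _root_.ABC) : Stub :=
  stub_of_facts_of_ABC (freyManinBound_of_facts h102 hopt hMK) hmod h

end Summit.ABC.ABC.Cruxes.SteinbergCore.StubIdeas2G2

end
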